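import Summits.ABC.StewartYu.PadicG3TwoScheduleS
import HarnessLib

/-!
# Cell abc-stewartyu, Gen-3 frame at `p = 2` (crux `Y07Two`, stmt-ABC-19659), layer F6/assembly, Option S′: the
# LEVEL-`0` INNER CHAIN FROM ALL NODES (Siegel delivers vanishing at every `|x| ≤ X`, not only at `3 ∤ x`)

`Summits/ABC/StewartYu/PadicG3TwoLevelZeroAll.lean` — cell `abc-stewartyu` (HOME `run/shared/lean/pub/abc-stewartyu/`),
route `PadicPrimesKummerThird`, seat p5 (g3); twin layer requested by the lead p3-g6 (STATUS 2026-08-27T03:12:52Z: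
the `(I,k) = (0,0)` budget line is 13 % short when sub-step `0` of level `0` runs from the coprime nodes only —
gain `2(X − X/3)·T` — but closes with 40 % to spare from ALL nodes — gain `(2X+1)·T`).  Two `Prop`-structures and
theorems; no named fact.

* `KChainTwoAll σ Sh I` — the inner chain of level `I` from vanishing at ALL nodes `|x| ≤ N0 I`;
* `mainTwoA` / `frameOutputTwo_of_mainTwoA` — the level induction with `KChainTwoAll` at level `0` and `KChainTwo`
  (coprime input, after a third step) at the levels `1 ≤ I ≤ I*`;
* `gainExpA`, `KFinalTwoAll σ I` (every sub-step from all nodes, gain `(2·Nsub I k + 1)·tdec I`),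
  `kchainTwoAll_of_kfinalAll`;
* `FrameNumericsTwoRA σ H L₀` (= `FrameNumericsTwoR` with `kfinal0 : KFinalTwoAll σ 0` and `kfinal` only for
  `1 ≤ I ≤ I*`), `levels_of_numericsRA`, **`frameTwoLast_of_numericsRA`**, **`stub_frameTwoLast_of_numericsRA`**;
* for the schedule of record: `kfinalTwoAll_schedTwoS`, **`frameNumericsTwoRA_schedTwoS`** (hypotheses: depth
  fit, (L1), (L2₀) = level `0` with `gainExpA`, (L2) for `1 ≤ I ≤ I*`, (L3ᴿ)).  (`gainExp ≤ gainExpA`: the all-nodes line is the WEAKER requirement.)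

WHAT THIS IS NOT: no numbers; no crux moves.

References: K. Yu, Acta Math. 211 (2013), Lemma 5.2 and (5.22); Yu. V. Nesterenko, LNM 1819 (2003), §4.1 (4.3)–(4.5).
-/

noncomputable section

open Finset Polynomial
open Literature.NumberTheory.Transcendental
open Literature.NumberTheory.Transcendental (FeldmanDelta.den)
open Literature.NumberTheory.Transcendental.FeldmanDelta
open Literature.NumberTheory.Transcendental.CW77 (heightProd)
open Literature.NumberTheory.Transcendental.CW77.Setup (Tau tauNorm)
open Literature.NumberTheory.Transcendental.PadicCW77 (condExp)

namespace Summit.ABC.StewartYu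

namespace TwoSetup

open Summit.ABC.StewartYu.FeldmanBasis Summit.ABC.StewartYu.G3Boxes

variable {S : TwoSetup} {ι : Type*} (σ : S.G3TwoSched) (Sh : ℕ → S.G3Fam ι → Prop)

/-! ### The chain from all nodes and the induction -/

/-- **The inner chain at level `I` from ALL nodes**: for every admissible family, vanishing at all `|x| ≤ N0 I`,
`|τ| < T0 I`, implies vanishing at all `|x| ≤ Nfin I`, `|τ| < Tfin I`. [cite: Yu2013, Lemma 5.2; shape only] -/
def KChainTwoAll (I : ℕ) : Prop :=
  ∀ Λ : S.G3Fam ι, S.G3Adm σ Sh I Λ → Λ.vanish nodesAll (σ.N0 I) (σ.T0 I) →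
    Λ.vanish nodesAll (σ.Nfin I) (σ.Tfin I)

/-- **THE LEVEL INDUCTION with the all-nodes chain at level `0`**: Siegel + `KChainTwoAll 0` + `KChainTwo I`
(`1 ≤ I ≤ I*`) + the third steps ⇒ the last-level admissible family with its vanishing.
[cite: Yu2013, §5 (5.19)–(5.22); shape only] -/
theorem mainTwoA (hS : SiegelTwo σ Sh) (hk0 : KChainTwoAll σ Sh 0)
    (hk : ∀ I, 1 ≤ I → I ≤ σ.Istar → KChainTwo σ Sh I) (hth : ∀ I, I < σ.Istar → ThirdStepTwo σ Sh I) :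
    ∃ Λ : S.G3Fam ι, S.G3Adm σ Sh σ.Istar Λ ∧ Λ.vanish nodesAll (σ.Nfin σ.Istar) (σ.Tfin σ.Istar) := by
  have hall : ∀ I, I ≤ σ.Istar →
      ∃ Λ : S.G3Fam ι, S.G3Adm σ Sh I Λ ∧ Λ.vanish nodesAll (σ.Nfin I) (σ.Tfin I) := by
    intro I
    induction I with
    | zero =>
      intro _
      obtain ⟨Λ, hadm, hvan⟩ := hS
      exact ⟨Λ, hadm, hk0 Λ hadm hvan⟩
    | succ I ih =>
      intro hI
      obtain ⟨Λ, hadm, hvan⟩ := ih (by omega)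
      obtain ⟨Λ', hadm', hvan'⟩ := hth I (by omega) Λ hadm hvan
      exact ⟨Λ', hadm', hk (I + 1) (by omega) hI Λ' hadm' hvan'⟩
  exact hall σ.Istar le_rfl

/-- **`FrameOutputTwo` from the induction with the all-nodes chain at level `0`.**
[cite: Nesterenko2003, §5.1 (5.1)–(5.4)] [cite: Yu2013, §6; shape only] -/
theorem frameOutputTwo_of_mainTwoA (hS : SiegelTwo σ Sh) (hk0 : KChainTwoAll σ Sh 0)
    (hk : ∀ I, 1 ≤ I → I ≤ σ.Istar → KChainTwo σ Sh I) (hth : ∀ I, I < σ.Istar → ThirdStepTwo σ Sh I)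
    {X S₀ : ℕ} (hX : (S.d + 1 + 1) * X ≤ σ.Nfin σ.Istar) (hT : (S.d + 1 + 1) * S₀ < σ.Tfin σ.Istar) :
    GenThreeFrameSpecTwo.FrameOutputTwo (S.d + 1) S.toQ.all S.ball (Fin.last S.d) σ.D₀ S₀ X
      (Fin.snoc (σ.Dbox σ.Istar) (σ.Dθ σ.Istar)) := by
  obtain ⟨Λ, hadm, hvan⟩ := mainTwoA σ Sh hS hk0 hk hth
  exact frameOutputTwo_of_adm_vanish σ Sh hadm hvan hX hT

/-! ### The record's obligations for an all-nodes chain -/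

/-- **The number of zeros gained in sub-step `k` from all nodes**: `(2·Nsub I k + 1)·tdec I`.
[cite: Yu2013, (5.40)–(5.41); shape only] -/
def gainExpA (I k : ℕ) : ℕ := (2 * σ.Nsub I k + 1) * σ.tdec I

/-- The coprime gain is at most the all-nodes gain. [folklore] -/
theorem gainExp_le_gainExpA (I k : ℕ) : gainExp σ I k ≤ gainExpA σ I k := by
  unfold gainExp gainExpA
  split_ifs with hk
  · subst hk; exact Nat.mul_le_mul_right _ (by omega)
  · exact le_rfl

/-- **THE RECORD'S OBLIGATIONS FOR AN ALL-NODES INNER CHAIN OF LEVEL `I`** (= `KFinalTwo` with the gain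
`gainExpA` in every sub-step). [cite: Yu2013, Lemma 5.2 (5.28)–(5.31); shape only] -/
structure KFinalTwoAll (I : ℕ) : Prop where
  /-- the chain starts at the level's initial range -/
  Nsub_zero : σ.Nsub I 0 = σ.N0 I
  /-- the chain reaches the level's final range -/
  Nfin_le : σ.Nfin I ≤ σ.Nsub I (σ.kst I)
  /-- the chain's order budget -/
  Tfin_le : σ.Tfin I + σ.kst I * σ.tdec I ≤ σ.T0 I
  /-- at least one sub-step -/
  one_le_kst : 1 ≤ σ.kst I
  /-- positive order decrement -/
  one_le_tdec : 1 ≤ σ.tdec I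
  /-- the directional bound is a nonnegative number -/
  Xb_nonneg : 0 ≤ σ.Xb I
  /-- the `Y₀`-weight denominators are positive -/
  one_le_den₀ : ∀ (x : ℤ) (τ : Tau S.d), 1 ≤ σ.den₀ I x τ
  /-- the Liouville constant is positive -/
  KTwo_pos : ∀ (x : ℤ) (τ : Tau S.d), 0 < KTwo σ I x τ
  /-- the numeric inequality of every sub-step (all nodes) -/
  hfinal : ∀ k, k < σ.kst I → ∀ x₁ : ℤ, |x₁| ≤ (σ.Nsub I (k + 1) : ℤ) → ∀ τ : Tau S.d,
    tauNorm τ + σ.tdec I ≤ σ.T0 I - k * σ.tdec I →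
    max (σ.Bw I * ‖S.Λ₀‖ * (2 : ℝ) ^ σ.tdec I * (2 : ℝ) ^ condExp 2 (2 * σ.Nsub I k + 1) (σ.tdec I))
        (σ.Bw I / (4 * (2 : ℝ) ^ σ.m) ^ gainExpA σ I k) < 1 / KTwo σ I x₁ τ

/-- **THE ALL-NODES INNER CHAIN FROM THE RECORD'S NUMERICS**: `KFinalTwoAll σ I → KChainTwoAll σ Sh I` (every
sub-step by `g3_slab_kstep_Icc`). [cite: Yu2013, Lemma 5.2] [cite: Nesterenko2003, §4.1 (4.3)–(4.5)] -/
theorem kchainTwoAll_of_kfinalAll {I : ℕ} (hfin : KFinalTwoAll σ I) : KChainTwoAll σ Sh I := by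
  intro Λ hadm hvan
  obtain ⟨hBw0, hP0, hM0, hK⟩ := kstep_data_of_adm σ Sh hadm hfin.Xb_nonneg
  have ht : 1 ≤ σ.tdec I := hfin.one_le_tdec
  have hR : ∀ (x : ℤ) (τ : Tau S.d), ∀ i ∈ Λ.B, ∃ z₀ : ℤ,
      (σ.den₀ I x τ : ℚ) * (hasseDeriv τ.1 (Λ.R i)).eval (x : ℚ) = z₀ ∧ |z₀| ≤ σ.M₀ I x τ :=
    fun x τ i hi => hadm.hasse i hi x τ
  have hchain : ∀ k, k ≤ σ.kst I → Λ.vanish nodesAll (σ.Nsub I k) (σ.T0 I - k * σ.tdec I) := by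
    intro k
    induction k with
    | zero =>
      intro _
      rw [hfin.Nsub_zero, Nat.zero_mul, Nat.sub_zero]
      exact hvan
    | succ k ih =>
      intro hk
      have hprev := ih (by omega)
      have hzero : ∀ x : ℤ, |x| ≤ (σ.Nsub I k : ℤ) → ∀ τ'' : Tau S.d,
          tauNorm τ'' < σ.T0 I - k * σ.tdec I → S.g3φ Λ.R Λ.u Λ.uθ Λ.B Λ.p τ'' x = 0 :=
        fun x hx τ'' hτ'' => hprev x hx trivial τ'' hτ''
      have hfinalk := hfin.hfinal k (by omega)
      have key := S.g3_slab_kstep_Icc Λ.R Λ.u Λ.uθ Λ.B Λ.p Λ.i₀ hadm.slab (N := σ.Nsub I k)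
        (N' := σ.Nsub I (k + 1)) (Tlo := σ.T0 I - k * σ.tdec I) ht hBw0 hadm.wt hzero hadm.u_le
        hadm.uθ_le (σ.den₀ I) hfin.one_le_den₀ (σ.M₀ I) hR hadm.dir_le hadm.p_le (KTwo σ I)
        hfin.KTwo_pos hK hfinalk
      intro x hx _ τ hτ
      refine key x hx τ ?_
      rw [Nat.succ_mul] at hτ
      omega
  have hlast := hchain (σ.kst I) le_rfl
  refine Λ.vanish_mono hfin.Nfin_le ?_ hlast
  have := hfin.Tfin_le
  omega

/-! ### The record bundle with the all-nodes chain at level `0` -/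

/-- **THE RECORD'S COMPLETE OBLIGATION LIST (v2, all-nodes chain at level `0`)**: `FrameNumericsTwoR` with
`kfinal0 : KFinalTwoAll σ 0` and `kfinal` only for `1 ≤ I ≤ I*`. [cite: Yu2013, §3.1 and (5.22); shape only] -/
structure FrameNumericsTwoRA (H L₀ : ℕ) : Prop where
  /-- the Fel'dman block is nonempty -/
  one_le_H : 1 ≤ H
  /-- at least one order at level `0` -/
  T0_pos : 1 ≤ σ.T0 0
  /-- Siegel's count on the slab class, sharp -/
  count : 2 * 2 ^ σ.m * ((2 * σ.N0 0 + 1) * (σ.T0 0 + S.d).choose (S.d + 1)) ≤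
    (L₀ + 1) * ((∏ j, (2 * σ.Dbox 0 j + 1)) * (2 * σ.Dθ 0 + 1))
  /-- the family-size slot at level `0` -/
  cardB0 : (famBox L₀ (σ.Dbox 0) (σ.Dθ 0)).card ≤ σ.cardB 0
  /-- the `Y₀`-degree slot -/
  L_le : L₀ ≤ σ.D₀
  /-- the directional slot at level `0` -/
  Xb0 : ∀ i ∈ famBox L₀ (σ.Dbox 0) (σ.Dθ 0), ∀ j, |S.dirScalar i.2.1 i.2.2 j| ≤ σ.Xb 0
  /-- the `2`-adic weight line at level `0` (radius `4·2^m`) -/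
  Bw0 : ∀ ℓ, ℓ ≤ L₀ → ‖((den ℓ H : ℚ_[2]))⁻¹‖ * (4 * (2 : ℝ) ^ σ.m) ^ ℓ ≤ σ.Bw 0
  /-- the `Y₀`-weight denominators are `ν(H)^t` at every level -/
  den₀_eq : ∀ (I : ℕ) (x : ℤ) (τ : Tau S.d), σ.den₀ I x τ = Nat.lcmUpto H ^ τ.1
  /-- Fel'dman's Hasse sizes at the points `3^{I*−I}x`, every level `I ≤ I*` -/
  M₀_ge : ∀ I, I ≤ σ.Istar → ∀ (x : ℤ) (τ : Tau S.d), ∀ ℓ, ℓ ≤ L₀ →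
    (3 : ℝ) ^ ((σ.Istar - I) * τ.1) * ((Nat.lcmUpto H : ℝ) ^ τ.1 *
      (Real.exp (H / Real.exp 1) * (Real.exp 1 * (1 + (3 : ℝ) ^ (σ.Istar - I) * |(x : ℝ)| / H)) ^ ℓ)) ≤
      σ.M₀ I x τ
  /-- the level-`0` Siegel size `Amax` and the coefficient slot `P` -/
  level0_size : ∃ (M₀E : ℤ) (Amax : ℝ), (∀ e ∈ eqSet S.d (σ.N0 0) (σ.T0 0), σ.M₀ 0 e.1 e.2 ≤ M₀E) ∧
    1 ≤ Amax ∧ (∀ e ∈ eqSet S.d (σ.N0 0) (σ.T0 0), (M₀E : ℝ) * (σ.Xb 0 : ℝ) ^ (∑ j, e.2.2 j) *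
      ((MonomialDen.monDen S.toQ.all (S.boxExp (σ.Dbox 0) (σ.Dθ 0) e.1) : ℝ)) ^ 2 ≤ Amax) ∧
    ⌈((famBox L₀ (σ.Dbox 0) (σ.Dθ 0)).card : ℝ) * Amax⌉ ≤ σ.P
  /-- the shrinking box slots -/
  box : ∀ I, I < σ.Istar → (∀ j, 2 * (σ.Dbox 0 j : ℤ) / 3 ^ (I + 1) ≤ (σ.Dbox (I + 1) j : ℤ)) ∧
    2 * (σ.Dθ 0 : ℤ) / 3 ^ (I + 1) ≤ (σ.Dθ (I + 1) : ℤ)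
  /-- the level-`0` inner chain, all nodes -/
  kfinal0 : KFinalTwoAll σ 0
  /-- the inner-chain numerics of the levels `1 ≤ I ≤ I*` -/
  kfinal : ∀ I, 1 ≤ I → I ≤ σ.Istar → KFinalTwo σ I
  /-- the third-step numerics (v2) of every level below the last -/
  third : ∀ I, I < σ.Istar → ThirdFinalTwoR σ I

/-- **THE LEVELS FROM THE NUMBERS (v2, all-nodes level `0`).** [cite: Yu2013, §5 (5.19)–(5.22); shape only] -/
theorem levels_of_numericsRA {H L₀ : ℕ} (hnum : FrameNumericsTwoRA σ H L₀)
    (hΛ : ‖S.Λ₀‖ ≤ ((2 : ℝ) ^ (σ.m + 3))⁻¹)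
    (hK : ∀ κ : Fin (S.d + 1) → ℕ, (∃ j, ¬ 3 ∣ κ j) → ∀ γ : ℚ, ∏ j, S.toQ.all j ^ κ j ≠ γ ^ 3) :
    SiegelTwo σ (ShFeldR σ σ.Istar H L₀) ∧ KChainTwoAll σ (ShFeldR σ σ.Istar H L₀) 0 ∧
      (∀ I, 1 ≤ I → I ≤ σ.Istar → KChainTwo σ (ShFeldR σ σ.Istar H L₀) I) ∧
      (∀ I, I < σ.Istar → ThirdStepTwo σ (ShFeldR σ σ.Istar H L₀) I) := by
  obtain ⟨M₀E, Amax, hM₀E, hAmax, hA, hP⟩ := hnum.level0_size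
  refine ⟨?_, kchainTwoAll_of_kfinalAll σ _ hnum.kfinal0,
    fun I h1 hI => kchainTwo_of_kfinal σ _ (hnum.kfinal I h1 hI), fun I hI => ?_⟩
  · refine siegelTwo_feldR_of_card σ H L₀ hnum.one_le_H hΛ hnum.T0_pos
      (siegel_count_choose σ.m L₀ (σ.Dbox 0) (σ.Dθ 0) (σ.N0 0) (σ.T0 0) hnum.count) hnum.cardB0 hnum.L_le
      hnum.Xb0 hnum.Bw0 (hnum.den₀_eq 0) ?_ hM₀E hAmax hA hP
    intro x τ ℓ hℓ
    have h := hnum.M₀_ge 0 (Nat.zero_le _) x τ ℓ hℓ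
    simpa only [Nat.sub_zero] using h
  · exact thirdStepTwo_ofR σ _ (hnum.third I hI)
      (basisStepTwoR_feld σ hnum.one_le_H hI (hnum.den₀_eq (I + 1)) (hnum.M₀_ge (I + 1) hI)
        (hnum.box I hI).1 (hnum.box I hI).2) hK

/-- **`FrameTwoLast C d` FROM THE RECORD (v2, all-nodes level `0`, monotone record slot).**
[cite: Yu2013, §5–§6; shape only] -/
theorem frameTwoLast_of_numericsRA {C : ℕ → ℝ} {d : ℕ}
    (h : ∀ (α : Fin (d + 1) → ℚ) (b : Fin (d + 1) → ℤ) (V : Fin (d + 1) → ℝ) (Vmax W : ℝ)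
      (hα : ∀ j, 3 ≤ padicValRat 2 (α j - 1)),
      (∀ μ : Fin (d + 1) → ℤ, ∏ j, α j ^ μ j = 1 → μ = 0) →
      (∀ κ : Fin (d + 1) → ℤ, (∃ γ : ℚ, ∏ j, α j ^ κ j = γ ^ 3) → ∀ j, (3 : ℤ) ∣ κ j) →
      (∀ j, Height.logHeight₁ (α j) ≤ V j) → (∀ j, 1 ≤ V j) → (∀ j, V j ≤ Vmax) →
      ∀ (hb : b (Fin.last d) ≠ 0)
        (hmin : ∀ j, b j ≠ 0 → padicValInt 2 (b (Fin.last d)) ≤ padicValInt 2 (b j)),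
      (∀ j, Real.log (max 3 (|b j| : ℝ)) ≤ W) → 1 ≤ W →
      ¬ (padicValRat 2 (∏ j, α j ^ b j - 1) : ℝ) ≤ C (d + 1) * (∏ j, V j) * (W + Real.log (2 * Vmax)) →
      ∃ (σ : (ofData d α b hα hb hmin).G3TwoSched) (H L₀ S₀ X D₀' : ℕ) (D' : Fin (d + 1) → ℕ),
        FrameNumericsTwoRA σ H L₀ ∧ ‖(ofData d α b hα hb hmin).Λ₀‖ ≤ ((2 : ℝ) ^ (σ.m + 3))⁻¹ ∧
        (d + 1 + 1) * X ≤ σ.Nfin σ.Istar ∧ (d + 1 + 1) * S₀ < σ.Tfin σ.Istar ∧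
        σ.D₀ ≤ D₀' ∧ (∀ j, (Fin.snoc (σ.Dbox σ.Istar) (σ.Dθ σ.Istar) : Fin (d + 1) → ℕ) j ≤ D' j) ∧
        GenThreeFrameSpecTwo.RecordTwo C (d + 1) V Vmax W D₀' S₀ X D') :
    GenThreeFramePivotTwo.FrameTwoLast C d := by
  intro α b V Vmax W hα hind hKZ hV hV1 hVmax hb hmin hW hW1 hneg
  obtain ⟨σ, H, L₀, S₀, X, D₀', D', hnum, hΛ, hX, hT, hD₀, hD, hrec⟩ :=
    h α b V Vmax W hα hind hKZ hV hV1 hVmax hb hmin hW hW1 hneg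
  have hK : ∀ κ : Fin (d + 1) → ℕ, (∃ j, ¬ 3 ∣ κ j) → ∀ γ : ℚ,
      ∏ j, (ofData d α b hα hb hmin).toQ.all j ^ κ j ≠ γ ^ 3 := by
    rw [ofData_all]
    exact KummerBasisChange.kummerNat_of_kummerInt 3 α hKZ
  obtain ⟨hS, hk0, hk, hth⟩ := levels_of_numericsRA σ hnum hΛ hK
  have hout := frameOutputTwo_of_mainTwoA σ (ShFeldR σ σ.Istar H L₀) hS hk0 hk hth hX hT
  rw [ofData_all, ofData_ball] at hout
  exact ⟨D₀', S₀, X, D', GenThreeFrameSpecTwo.frameOutputTwo_mono hD₀ hD hout, hrec⟩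

/-- **THE REGISTERED STUB'S TEXT FROM THE RECORD (v2, all-nodes level `0`)** — the form to instantiate for
`stub_frameTwoLast` of crux stmt-ABC-19659. [cite: Yu2007, Main Thm (K = ℚ, ℘ = 2); shape only] -/
theorem stub_frameTwoLast_of_numericsRA {C : ℕ → ℝ} {c₁ : ℝ} (hc₁ : 1 ≤ c₁)
    (hC : ∀ m, 0 ≤ C m ∧ C m ≤ c₁ ^ m) (hC1 : 4 ≤ C 1)
    (h : Nesterenko2003_prop51 → ∀ d, 1 ≤ d →
      ∀ (α : Fin (d + 1) → ℚ) (b : Fin (d + 1) → ℤ) (V : Fin (d + 1) → ℝ) (Vmax W : ℝ)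
      (hα : ∀ j, 3 ≤ padicValRat 2 (α j - 1)),
      (∀ μ : Fin (d + 1) → ℤ, ∏ j, α j ^ μ j = 1 → μ = 0) →
      (∀ κ : Fin (d + 1) → ℤ, (∃ γ : ℚ, ∏ j, α j ^ κ j = γ ^ 3) → ∀ j, (3 : ℤ) ∣ κ j) →
      (∀ j, Height.logHeight₁ (α j) ≤ V j) → (∀ j, 1 ≤ V j) → (∀ j, V j ≤ Vmax) →
      ∀ (hb : b (Fin.last d) ≠ 0)
        (hmin : ∀ j, b j ≠ 0 → padicValInt 2 (b (Fin.last d)) ≤ padicValInt 2 (b j)),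
      (∀ j, Real.log (max 3 (|b j| : ℝ)) ≤ W) → 1 ≤ W →
      ¬ (padicValRat 2 (∏ j, α j ^ b j - 1) : ℝ) ≤ C (d + 1) * (∏ j, V j) * (W + Real.log (2 * Vmax)) →
      ∃ (σ : (ofData d α b hα hb hmin).G3TwoSched) (H L₀ S₀ X D₀' : ℕ) (D' : Fin (d + 1) → ℕ),
        FrameNumericsTwoRA σ H L₀ ∧ ‖(ofData d α b hα hb hmin).Λ₀‖ ≤ ((2 : ℝ) ^ (σ.m + 3))⁻¹ ∧
        (d + 1 + 1) * X ≤ σ.Nfin σ.Istar ∧ (d + 1 + 1) * S₀ < σ.Tfin σ.Istar ∧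
        σ.D₀ ≤ D₀' ∧ (∀ j, (Fin.snoc (σ.Dbox σ.Istar) (σ.Dθ σ.Istar) : Fin (d + 1) → ℕ) j ≤ D' j) ∧
        GenThreeFrameSpecTwo.RecordTwo C (d + 1) V Vmax W D₀' S₀ X D') :
    ∃ (C : ℕ → ℝ) (c₁ : ℝ), 1 ≤ c₁ ∧ (∀ m, 0 ≤ C m ∧ C m ≤ c₁ ^ m) ∧ 4 ≤ C 1 ∧
      (Nesterenko2003_prop51 → ∀ d, 1 ≤ d → GenThreeFramePivotTwo.FrameTwoLast C d) :=
  ⟨C, c₁, hc₁, hC, hC1, fun hZ d hd => frameTwoLast_of_numericsRA (h hZ d hd)⟩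

/-! ### For the schedule of record -/

variable (S) (P : PadicG3Par (S.d + 1))

/-- **Level-`0` all-nodes chain obligations of `schedTwoS`** from the k-step lines (L2₀).
[cite: Nesterenko2003, §4; shape only] -/
theorem kfinalTwoAll_schedTwoS (hT : 8 ≤ S.T3 P 0)
    (hL2₀ : ∀ k, k < (S.schedTwoS P).kst 0 → ∀ x₁ : ℤ, |x₁| ≤ ((S.schedTwoS P).Nsub 0 (k + 1) : ℤ) →
      ∀ τ : Tau S.d, tauNorm τ + (S.schedTwoS P).tdec 0 ≤ (S.schedTwoS P).T0 0 - k * (S.schedTwoS P).tdec 0 →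
      max ((S.schedTwoS P).Bw 0 * ‖S.Λ₀‖ * (2 : ℝ) ^ (S.schedTwoS P).tdec 0 *
            (2 : ℝ) ^ condExp 2 (2 * (S.schedTwoS P).Nsub 0 k + 1) ((S.schedTwoS P).tdec 0))
          ((S.schedTwoS P).Bw 0 / (4 * (2 : ℝ) ^ (S.schedTwoS P).m) ^ gainExpA (S.schedTwoS P) 0 k) <
        1 / KTwo (S.schedTwoS P) 0 x₁ τ) :
    KFinalTwoAll (S.schedTwoS P) 0 where
  Nsub_zero := rfl
  Nfin_le := by
    rw [schedTwoS_Nfin, schedTwoS_Nsub, schedTwoS_kst]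
    unfold Nsub3
    rw [if_neg (by omega)]
  Tfin_le := by
    rw [schedTwoS_Tfin, schedTwoS_kst, schedTwoS_tdec, schedTwoS_T0]
    have := (S.T03_budget3 P 0 hT).1
    omega
  one_le_kst := by rw [schedTwoS_kst]; omega
  one_le_tdec := by rw [schedTwoS_tdec]; omega
  Xb_nonneg := le_trans zero_le_one (S.one_le_Xb3R P 0)
  one_le_den₀ := fun _ _ => Nat.one_le_pow _ _ (Nat.lcmUpto_pos P.H)
  KTwo_pos := S.KTwo_schedTwoS_pos P 0
  hfinal := hL2₀

/-- **THE FRAME NUMERICS (v2, all-nodes level `0`) OF `schedTwoS` FROM THE BUDGET LINES**: depth fit, (L1),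
(L2₀) = level `0` with the all-nodes gain, (L2) for `1 ≤ I ≤ I*`, (L3ᴿ).
[cite: Nesterenko2003, §4 (4.3)–(4.5), (4.35) and Prop 3.9; shape only] -/
theorem frameNumericsTwoRA_schedTwoS
    (hdepth : 8 * 3 ^ S.Istar3 P ≤ 4 * P.L)
    (hL1 : 2 * 2 ^ (S.schedTwoS P).m *
        ((2 * (S.schedTwoS P).N0 0 + 1) * ((S.schedTwoS P).T0 0 + S.d).choose (S.d + 1)) ≤
      (P.L₀ + 1) * ((∏ j, (2 * (S.schedTwoS P).Dbox 0 j + 1)) * (2 * (S.schedTwoS P).Dθ 0 + 1)))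
    (hL2₀ : ∀ k, k < (S.schedTwoS P).kst 0 → ∀ x₁ : ℤ, |x₁| ≤ ((S.schedTwoS P).Nsub 0 (k + 1) : ℤ) →
      ∀ τ : Tau S.d, tauNorm τ + (S.schedTwoS P).tdec 0 ≤ (S.schedTwoS P).T0 0 - k * (S.schedTwoS P).tdec 0 →
      max ((S.schedTwoS P).Bw 0 * ‖S.Λ₀‖ * (2 : ℝ) ^ (S.schedTwoS P).tdec 0 *
            (2 : ℝ) ^ condExp 2 (2 * (S.schedTwoS P).Nsub 0 k + 1) ((S.schedTwoS P).tdec 0))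
          ((S.schedTwoS P).Bw 0 / (4 * (2 : ℝ) ^ (S.schedTwoS P).m) ^ gainExpA (S.schedTwoS P) 0 k) <
        1 / KTwo (S.schedTwoS P) 0 x₁ τ)
    (hL2 : ∀ I, 1 ≤ I → I ≤ S.Istar3 P → ∀ k, k < (S.schedTwoS P).kst I → ∀ x₁ : ℤ,
      |x₁| ≤ ((S.schedTwoS P).Nsub I (k + 1) : ℤ) →
      ∀ τ : Tau S.d, tauNorm τ + (S.schedTwoS P).tdec I ≤ (S.schedTwoS P).T0 I - k * (S.schedTwoS P).tdec I →
      max ((S.schedTwoS P).Bw I * ‖S.Λ₀‖ * (2 : ℝ) ^ (S.schedTwoS P).tdec I *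
            (2 : ℝ) ^ condExp 2 (2 * (S.schedTwoS P).Nsub I k + 1) ((S.schedTwoS P).tdec I))
          ((S.schedTwoS P).Bw I / (4 * (2 : ℝ) ^ (S.schedTwoS P).m) ^ gainExp (S.schedTwoS P) I k) <
        1 / KTwo (S.schedTwoS P) I x₁ τ)
    (hL3 : ∀ I, I < S.Istar3 P → ∀ s : ℤ, |s| ≤ ((S.schedTwoS P).N0 (I + 1) : ℤ) → ¬ (3 : ℤ) ∣ s →
      ∀ τ : Tau S.d, tauNorm τ < (S.schedTwoS P).T0 (I + 1) →
      max ((S.schedTwoS P).Bw I * ‖S.Λ₀‖ * (2 : ℝ) ^ ((S.schedTwoS P).Tfin I - (S.schedTwoS P).T0 (I + 1)) *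
            (2 : ℝ) ^ condExp 2 (2 * (S.schedTwoS P).Nfin I + 1)
              ((S.schedTwoS P).Tfin I - (S.schedTwoS P).T0 (I + 1)))
          ((S.schedTwoS P).Bw I / (4 * (2 : ℝ) ^ (S.schedTwoS P).m) ^
            ((2 * (S.schedTwoS P).Nfin I + 1) * ((S.schedTwoS P).Tfin I - (S.schedTwoS P).T0 (I + 1)))) <
        1 / (6 * (thirdDen (S.schedTwoS P) I s τ : ℝ) * thirdM (S.schedTwoS P) I s τ *
          heightProd S.toQ.all ^ 5) ^ (3 ^ (S.d + 1 + 1) - 1)) :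
    FrameNumericsTwoRA (S.schedTwoS P) P.H P.L₀ := by
  have hT8 : ∀ I, I ≤ S.Istar3 P → 8 ≤ S.T3 P I := by
    intro I hI
    unfold T3
    have h3 : 3 ^ I ≤ 3 ^ S.Istar3 P := Nat.pow_le_pow_right (by norm_num) hI
    have hpos : 0 < 3 ^ I := by positivity
    rw [Nat.le_div_iff_mul_le hpos]
    calc 8 * 3 ^ I ≤ 8 * 3 ^ S.Istar3 P := Nat.mul_le_mul_left _ h3
      _ ≤ 4 * P.L := hdepth
  refine
    { one_le_H := le_max_left _ _
      T0_pos := S.one_le_T03 P 0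
      count := hL1
      cardB0 := by rw [schedTwoS_Dbox, schedTwoS_Dθ, Dbox3R_zero, Dθ3R_zero, schedTwoS_cardB]
      L_le := le_rfl
      Xb0 := ?_
      Bw0 := fun ℓ hℓ => S.Bw3_ge P ℓ hℓ
      den₀_eq := fun _ _ _ => rfl
      M₀_ge := fun I _ x τ ℓ hℓ => S.M₀3_ge P I x τ ℓ hℓ
      level0_size := ?_
      box := ?_
      kfinal0 := S.kfinalTwoAll_schedTwoS P (hT8 0 (Nat.zero_le _)) hL2₀
      kfinal := fun I h1 hI => S.kfinalTwo_schedTwoS P I (hT8 I hI) (hL2 I h1 hI)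
      third := fun I hI => S.thirdFinalTwoR_schedTwoS P I (hT8 I hI.le) (hL3 I hI) }
  · intro i hi j
    rw [schedTwoS_Xb]
    rw [schedTwoS_Dbox, schedTwoS_Dθ, Dbox3R_zero, Dθ3R_zero] at hi
    have hb := (mem_famBox.mp hi).2
    have h := S.Xb3R_ge P 0 j
    rw [Dbox3R_zero, Dθ3R_zero] at h
    exact (S.abs_dirScalar_le hb.1 hb.2 j).trans h
  · refine ⟨S.M₀E3 P (S.one_le_T03 P 0), S.Amax3 P (S.one_le_T03 P 0), ?_, le_max_left _ _, ?_, ?_⟩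
    · intro e he
      rw [schedTwoS_M₀]
      rw [schedTwoS_N0, schedTwoS_T0, Nsub3_zero_zero] at he
      exact S.M₀3_le_M₀E3 P _ he
    · intro e he
      rw [schedTwoS_Xb, schedTwoS_Dbox, schedTwoS_Dθ, Dbox3R_zero, Dθ3R_zero, Xb3R_zero]
      rw [schedTwoS_N0, schedTwoS_T0, Nsub3_zero_zero] at he
      exact S.prod_le_Amax3 P _ he
    · rw [schedTwoS_P, schedTwoS_Dbox, schedTwoS_Dθ, Dbox3R_zero, Dθ3R_zero]
  · intro I _
    rw [schedTwoS_Dbox, schedTwoS_Dθ, Dbox3R_zero, Dθ3R_zero]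
    refine ⟨fun j => ?_, ?_⟩
    · rw [Dbox3R_succ]; push_cast; exact le_rfl
    · rw [Dθ3R_succ]; push_cast; exact le_rfl

end TwoSetup

end Summit.ABC.StewartYu

end
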